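import Summits.ValiantsHypothesis.ValiantsHypothesis.Theorems.KPlusLogSqLawOctaveNewtonCells

/-!
# Route «KPlusLogSqLaw», octave door — line «newton-cells», part 2: THE HEIGHT RUNG (sorry-free)

HONEST FRAMING.  Helper file `--supports stmt-ValiantsHypothesis-19561` (crux `WeakLifting`, OPEN), line «newton-cells» (val-idea-1 g4).  Nothing here
asserts a candidate law; `OctaveWeakLifting`, `WeakLifting`, `TropicalB`, Conjecture B stay OPEN; VP ≠ VNP is not moved.

`card_newtonCells_le_of_height`: if the nonzero coefficients of `f` lie in `[A, A·2^h]` in absolute value then `#newtonCells f ≤ 2⌊√(2h)⌋ + 2` —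
cells grow like the SQUARE ROOT of the coefficient height (one-sided bound tight: `c_e = 2^{−e(e−1)/2}` has `N` cells at height `N(N−1)/2`).
Proof: one breakpoint per nonnegative cell `c₁ < c₂ < …` with its two top exponents `u < v`; top exponents are monotone in the slope (`top_mono`),
so the heights telescope (`chain_bound`): `L(u₁) − L(v_N) ≥ Σ_j b_j ≥ Σ_j c_j ≥ N(N−1)/2` (`card_mul_pred_le_two_sum`), every height lies in
`[log₂A, log₂A + h]`; mirrored for negative cells.  Corollary `octaveCount_le_of_height : Ω(f) ≤ (2(⌊log₂t⌋+2)+2)·(2⌊√(2h)⌋+2)`.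
Informal consequence (not formalised): a `NewtonCellLifting`-counterexample with `V₁ > N` needs coefficient height `> (N−2)²/8`, doubly exponential
in the format. [folklore]
-/

set_option linter.dupNamespace false
set_option autoImplicit false

namespace Summit.ValiantsHypothesis.ValiantsHypothesis.Theorems.KPlusLogSqLaw.Octave

open Polynomial Finset
open scoped BigOperators

/-! ### R3: the height rung

`card_newtonCells_le_of_height`: if the nonzero coefficients of `f` lie in `[A, A·2^h]` in absolute value then `V₁(f) ≤ 2⌊√(2h)⌋ + 2`
(one-sided bound tight: `c_e = 2^{−e(e−1)/2}` has `V₁ = N`, `h = N(N−1)/2`).  PRECISION PRICE: a `NewtonCellLifting`-violator with `V₁ > N` needs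
coefficient height `h > (N−2)²/8` — doubly exponential in the format for `N = 2^{C(K+log²m)}(n+1)`.  Proof: one breakpoint per nonnegative cell
`c₁ < c₂ < …`, its two top exponents `u < v`; top exponents are monotone in the slope (`top_mono`), so the heights telescope:
`L(u₁) − L(v_N) ≥ Σ_j b_j ≥ Σ_j c_j ≥ N(N−1)/2`, and every height lies in `[log₂A, log₂A + h]`; mirrored for negative cells. -/

/-- sum of distinct naturals: `|S|(|S|-1) ≤ 2 Σ_{c∈S} c`. -/
theorem card_mul_pred_le_two_sum (S : Finset ℕ) : (S.card : ℝ) * (S.card - 1) ≤ 2 * ∑ c ∈ S, (c : ℝ) := by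
  induction S using Finset.induction_on_max with
  | empty => simp
  | insert a s ha ih =>
    have has : a ∉ s := fun h => lt_irrefl a (ha a h)
    have hsub : s ⊆ Finset.range a := fun x hx => Finset.mem_range.2 (ha x hx)
    have hcard : (s.card : ℝ) ≤ a := by exact_mod_cast (Finset.card_le_card hsub).trans (by simp)
    rw [Finset.sum_insert has, Finset.card_insert_of_notMem has]
    push_cast
    nlinarith [ih, hcard]

/-- telescoping chain bound: cells `S ⊆ ℕ` with start/end heights `f c ≥ g c + c`, chained `g c ≥ f c'` for `c < c'`, all heights in `[A, A+h]`
⇒ `|S|(|S|-1) ≤ 2h`. -/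
theorem chain_bound (S : Finset ℕ) (f g : ℕ → ℝ) (A h : ℝ) (h0 : 0 ≤ h)
    (hdrop : ∀ c ∈ S, g c + c ≤ f c) (hchain : ∀ c ∈ S, ∀ c' ∈ S, c < c' → f c' ≤ g c)
    (hhi : ∀ c ∈ S, f c ≤ A + h) (hlo : ∀ c ∈ S, A ≤ g c) :
    (S.card : ℝ) * (S.card - 1) ≤ 2 * h := by
  -- P s : s ⊆ S → s = ∅ ∨ ∃ cmin ∈ s, ∃ cmax ∈ s, Σ_{c∈s} c ≤ f cmin - g cmax
  have key : ∀ s : Finset ℕ, s ⊆ S → s = ∅ ∨ ∃ cmin ∈ s, ∃ cmax ∈ s, (∑ c ∈ s, (c : ℝ)) ≤ f cmin - g cmax := by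
    intro s
    induction s using Finset.induction_on_max with
    | empty => intro _; exact Or.inl rfl
    | insert a s ha ih =>
      intro hsub
      right
      have has : a ∉ s := fun h' => lt_irrefl a (ha a h')
      have haS : a ∈ S := hsub (Finset.mem_insert_self a s)
      have hsS : s ⊆ S := fun x hx => hsub (Finset.mem_insert_of_mem hx)
      rcases ih hsS with hs0 | ⟨cmin, hcmin, cmax, hcmax, hsum⟩
      · subst hs0
        refine ⟨a, Finset.mem_insert_self a _, a, Finset.mem_insert_self a _, ?_⟩
        rw [Finset.sum_insert has, Finset.sum_empty, add_zero]
        linarith [hdrop a haS]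
      · refine ⟨cmin, Finset.mem_insert_of_mem hcmin, a, Finset.mem_insert_self a s, ?_⟩
        rw [Finset.sum_insert has]
        have h1 := hdrop a haS
        have h2 := hchain cmax (hsS hcmax) a haS (ha cmax hcmax)
        linarith
  rcases key S (subset_refl S) with h0 | ⟨cmin, hcmin, cmax, hcmax, hsum⟩
  · subst h0; simp; linarith
  · have := card_mul_pred_le_two_sum S
    have hb : f cmin - g cmax ≤ h := by linarith [hhi cmin hcmin, hlo cmax hcmax]
    linarith



/-- `e` is a top exponent of `p` at slope `θ`. -/
def IsTop (p : ℝ[X]) (e : ℕ) (θ : ℝ) : Prop := ∀ t ∈ p.support, newtonLog p t + t * θ ≤ newtonLog p e + e * θ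

/-- top exponents are monotone in the slope. [folklore] -/
theorem top_mono (p : ℝ[X]) {e e' : ℕ} {θ θ' : ℝ} (he : e ∈ p.support) (he' : e' ∈ p.support)
    (ht : IsTop p e θ) (ht' : IsTop p e' θ') (hθ : θ < θ') : e ≤ e' := by
  have h1 := ht e' he'
  have h2 := ht' e he
  by_contra hlt
  rw [not_le] at hlt
  have hlt' : (e' : ℝ) < e := by exact_mod_cast hlt
  nlinarith [mul_pos (sub_pos.2 hlt') (sub_pos.2 hθ)]

/-- a breakpoint carries two distinct top exponents. [folklore] -/
theorem exists_tops_of_mem_newtonBreaks (p : ℝ[X]) {b : ℝ} (hb : b ∈ newtonBreaks p) :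
    ∃ u v : ℕ, u ∈ p.support ∧ v ∈ p.support ∧ u < v ∧ IsTop p u b ∧ IsTop p v b := by
  classical
  unfold newtonBreaks at hb
  rw [Finset.mem_image] at hb
  obtain ⟨⟨k, l⟩, hmem, hcross⟩ := hb
  rw [Finset.mem_filter, Finset.mem_product] at hmem
  obtain ⟨⟨hk, hl⟩, hkl, htop⟩ := hmem
  simp only at hk hl hkl
  have htopk : IsTop p k b := by
    intro t ht
    have := htop t ht
    rwa [hcross] at this
  have heq : newtonLog p l + l * b = newtonLog p k + k * b := by
    have hne : ((l : ℝ) - k) ≠ 0 := sub_ne_zero.2 (by exact_mod_cast (Ne.symm hkl))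
    have hb' : b * ((l : ℝ) - k) = newtonLog p k - newtonLog p l := by
      rw [← hcross]; unfold newtonCross; field_simp
    linarith [hb']
  have htopl : IsTop p l b := fun t ht => heq ▸ (htopk t ht)
  rcases lt_or_gt_of_ne hkl with h | h
  · exact ⟨k, l, hk, hl, h, htopk, htopl⟩
  · exact ⟨l, k, hl, hk, h, htopl, htopk⟩

/-- heights of support exponents under a dynamic-range hypothesis. [folklore] -/
theorem newtonLog_mem_Icc (p : ℝ[X]) (A : ℝ) (hA : 0 < A) (h : ℕ)
    (hlo : ∀ e ∈ p.support, A ≤ |p.coeff e|) (hhi : ∀ e ∈ p.support, |p.coeff e| ≤ A * 2 ^ h)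
    {e : ℕ} (he : e ∈ p.support) :
    Real.logb 2 A ≤ newtonLog p e ∧ newtonLog p e ≤ Real.logb 2 A + h := by
  unfold newtonLog
  have hpos : 0 < |p.coeff e| := lt_of_lt_of_le hA (hlo e he)
  refine ⟨Real.logb_le_logb_of_le one_lt_two hA (hlo e he), ?_⟩
  calc Real.logb 2 |p.coeff e| ≤ Real.logb 2 (A * 2 ^ h) := Real.logb_le_logb_of_le one_lt_two hpos (hhi e he)
    _ = Real.logb 2 A + h := by
        rw [Real.logb_mul hA.ne' (by positivity), Real.logb_pow, Real.logb_self_eq_one one_lt_two]; ring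


/-- **nonnegative cells**: `N₊(N₊ − 1) ≤ 2h`. [folklore] -/
theorem nonneg_cells_bound (p : ℝ[X]) (A : ℝ) (hA : 0 < A) (h : ℕ)
    (hlo : ∀ e ∈ p.support, A ≤ |p.coeff e|) (hhi : ∀ e ∈ p.support, |p.coeff e| ≤ A * 2 ^ h) :
    ((((newtonCells p).filter (fun c => 0 ≤ c)).card : ℝ)) * ((((newtonCells p).filter (fun c => 0 ≤ c)).card : ℝ) - 1) ≤ 2 * h := by
  classical
  -- one breakpoint per cell, two tops per breakpoint
  have hsel : ∀ c ∈ newtonCells p, ∃ b ∈ newtonBreaks p, ⌊b⌋ = c := fun c hc => by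
    simpa [newtonCells] using hc
  choose! B hBmem hBfloor using hsel
  have htops : ∀ b ∈ newtonBreaks p, ∃ u v : ℕ, u ∈ p.support ∧ v ∈ p.support ∧ u < v ∧ IsTop p u b ∧ IsTop p v b :=
    fun b hb => exists_tops_of_mem_newtonBreaks p hb
  choose! U V hU hV hUV hTU hTV using htops
  set C := (newtonCells p).filter (fun c => 0 ≤ c) with hC
  set S : Finset ℕ := C.image Int.toNat with hS
  have hinj : Set.InjOn Int.toNat (C : Set ℤ) := by
    intro c hc c' hc' hcc'
    have h0c : 0 ≤ c := (Finset.mem_filter.1 hc).2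
    have h0c' : 0 ≤ c' := (Finset.mem_filter.1 hc').2
    have := congrArg (fun n : ℕ => (n : ℤ)) hcc'
    simpa [Int.toNat_of_nonneg h0c, Int.toNat_of_nonneg h0c'] using this
  have hcardS : S.card = C.card := Finset.card_image_of_injOn hinj
  -- data of a member of S
  have hmemS : ∀ n ∈ S, ((n : ℤ) ∈ newtonCells p) ∧ (0 : ℤ) ≤ n ∧ ((n : ℕ) : ℝ) = (((n : ℤ)) : ℝ) := by
    intro n hn
    obtain ⟨c, hc, hcn⟩ := Finset.mem_image.1 hn
    have h0c : 0 ≤ c := (Finset.mem_filter.1 hc).2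
    have hnc : (n : ℤ) = c := by rw [← hcn]; exact Int.toNat_of_nonneg h0c
    refine ⟨hnc ▸ (Finset.mem_filter.1 hc).1, by omega, ?_⟩
    exact_mod_cast rfl
  let f : ℕ → ℝ := fun n => newtonLog p (U (B (n : ℤ)))
  let g : ℕ → ℝ := fun n => newtonLog p (V (B (n : ℤ)))
  have key := chain_bound S f g (Real.logb 2 A) h (Nat.cast_nonneg h) ?_ ?_ ?_ ?_
  · rw [hcardS] at key; exact key
  · -- drop: g n + n ≤ f n
    intro n hn
    obtain ⟨hcell, h0n, hcast⟩ := hmemS n hn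
    set c : ℤ := (n : ℤ) with hc
    have hb := hBmem c hcell
    have hfl := hBfloor c hcell
    have hu := hU _ hb; have hv := hV _ hb; have huv := hUV _ hb; have htu := hTU _ hb
    have h1 := htu (V (B c)) hv      -- L v + v b ≤ L u + u b
    have hbc : (c : ℝ) ≤ B c := by have := Int.floor_le (B c); rw [hfl] at this; exact this
    have hb0 : (0 : ℝ) ≤ B c := le_trans (by exact_mod_cast h0n) hbc
    have hvu : (1 : ℝ) ≤ (V (B c) : ℝ) - U (B c) := by
      have : U (B c) + 1 ≤ V (B c) := huv
      have : ((U (B c) : ℕ) : ℝ) + 1 ≤ V (B c) := by exact_mod_cast this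
      linarith
    show newtonLog p (V (B c)) + (n : ℝ) ≤ newtonLog p (U (B c))
    have hn : ((n : ℕ) : ℝ) = (c : ℝ) := hcast
    nlinarith [mul_le_mul_of_nonneg_right hvu hb0]
  · -- chain: n < n' ⇒ f n' ≤ g n
    intro n hn n' hn' hnn'
    obtain ⟨hcell, h0n, _⟩ := hmemS n hn
    obtain ⟨hcell', h0n', _⟩ := hmemS n' hn'
    have hb := hBmem (n : ℤ) hcell; have hb' := hBmem (n' : ℤ) hcell'
    have hfl := hBfloor (n : ℤ) hcell; have hfl' := hBfloor (n' : ℤ) hcell'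
    have hlt : B (n : ℤ) < B (n' : ℤ) := by
      by_contra hle; rw [not_lt] at hle
      have := Int.floor_le_floor hle
      rw [hfl, hfl'] at this
      exact absurd this (not_le.2 (by exact_mod_cast hnn'))
    have hmono : V (B (n : ℤ)) ≤ U (B (n' : ℤ)) :=
      top_mono p (hV _ hb) (hU _ hb') (hTV _ hb) (hTU _ hb') hlt
    have h1 := (hTV _ hb) (U (B (n' : ℤ))) (hU _ hb')   -- L u' + u' b ≤ L v + v b
    have hb0 : (0 : ℝ) ≤ B (n : ℤ) := by
      have := Int.floor_le (B (n : ℤ)); rw [hfl] at this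
      exact le_trans (by exact_mod_cast h0n) this
    have hmono' : ((V (B (n : ℤ)) : ℕ) : ℝ) ≤ U (B (n' : ℤ)) := by exact_mod_cast hmono
    show newtonLog p (U (B (n' : ℤ))) ≤ newtonLog p (V (B (n : ℤ)))
    nlinarith [mul_le_mul_of_nonneg_right hmono' hb0]
  · intro n hn
    obtain ⟨hcell, _, _⟩ := hmemS n hn
    exact (newtonLog_mem_Icc p A hA h hlo hhi (hU _ (hBmem _ hcell))).2
  · intro n hn
    obtain ⟨hcell, _, _⟩ := hmemS n hn
    exact (newtonLog_mem_Icc p A hA h hlo hhi (hV _ (hBmem _ hcell))).1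

/-- **negative cells**: `N₋(N₋ − 1) ≤ 2h`. [folklore] -/
theorem neg_cells_bound (p : ℝ[X]) (A : ℝ) (hA : 0 < A) (h : ℕ)
    (hlo : ∀ e ∈ p.support, A ≤ |p.coeff e|) (hhi : ∀ e ∈ p.support, |p.coeff e| ≤ A * 2 ^ h) :
    ((((newtonCells p).filter (fun c => c < 0)).card : ℝ)) * ((((newtonCells p).filter (fun c => c < 0)).card : ℝ) - 1) ≤ 2 * h := by
  classical
  have hsel : ∀ c ∈ newtonCells p, ∃ b ∈ newtonBreaks p, ⌊b⌋ = c := fun c hc => by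
    simpa [newtonCells] using hc
  choose! B hBmem hBfloor using hsel
  have htops : ∀ b ∈ newtonBreaks p, ∃ u v : ℕ, u ∈ p.support ∧ v ∈ p.support ∧ u < v ∧ IsTop p u b ∧ IsTop p v b :=
    fun b hb => exists_tops_of_mem_newtonBreaks p hb
  choose! U V hU hV hUV hTU hTV using htops
  set C := (newtonCells p).filter (fun c => c < 0) with hC
  set S : Finset ℕ := C.image (fun c => (-c - 1).toNat) with hS
  have hinj : Set.InjOn (fun c : ℤ => (-c - 1).toNat) (C : Set ℤ) := by
    intro c hc c' hc' hcc'
    have h0c : c < 0 := (Finset.mem_filter.1 hc).2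
    have h0c' : c' < 0 := (Finset.mem_filter.1 hc').2
    have := congrArg (fun n : ℕ => (n : ℤ)) hcc'
    simp only at this
    rw [Int.toNat_of_nonneg (by omega), Int.toNat_of_nonneg (by omega)] at this
    omega
  have hcardS : S.card = C.card := Finset.card_image_of_injOn hinj
  have hmemS : ∀ n ∈ S, ((-(n : ℤ) - 1) ∈ newtonCells p) := by
    intro n hn
    obtain ⟨c, hc, hcn⟩ := Finset.mem_image.1 hn
    have h0c : c < 0 := (Finset.mem_filter.1 hc).2
    have hnc : (n : ℤ) = -c - 1 := by rw [← hcn]; exact Int.toNat_of_nonneg (by omega)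
    have : (-(n : ℤ) - 1) = c := by omega
    rw [this]; exact (Finset.mem_filter.1 hc).1
  let cell : ℕ → ℤ := fun n => -(n : ℤ) - 1
  let f : ℕ → ℝ := fun n => newtonLog p (V (B (cell n)))
  let g : ℕ → ℝ := fun n => newtonLog p (U (B (cell n)))
  have hneg : ∀ n ∈ S, B (cell n) < -(n : ℝ) := by
    intro n hn
    have hcell := hmemS n hn
    have := Int.lt_floor_add_one (B (cell n))
    rw [hBfloor _ hcell] at this
    have e : (((cell n : ℤ)) : ℝ) = -(n : ℝ) - 1 := by simp [cell]
    linarith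
  have key := chain_bound S f g (Real.logb 2 A) h (Nat.cast_nonneg h) ?_ ?_ ?_ ?_
  · rw [hcardS] at key; exact key
  · intro n hn
    have hcell := hmemS n hn
    have hb := hBmem _ hcell
    have hu := hU _ hb; have hv := hV _ hb; have huv := hUV _ hb
    have h1 := (hTV _ hb) (U (B (cell n))) hu      -- L u + u b ≤ L v + v b
    have hbn := hneg n hn
    have hvu : (1 : ℝ) ≤ (V (B (cell n)) : ℝ) - U (B (cell n)) := by
      have : U (B (cell n)) + 1 ≤ V (B (cell n)) := huv
      have : ((U (B (cell n)) : ℕ) : ℝ) + 1 ≤ V (B (cell n)) := by exact_mod_cast this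
      linarith
    show newtonLog p (U (B (cell n))) + (n : ℝ) ≤ newtonLog p (V (B (cell n)))
    have hn0 : (0 : ℝ) ≤ n := Nat.cast_nonneg n
    nlinarith [mul_le_mul_of_nonneg_right hvu (by linarith : (0 : ℝ) ≤ -B (cell n))]
  · intro n hn n' hn' hnn'
    have hcell := hmemS n hn; have hcell' := hmemS n' hn'
    have hb := hBmem _ hcell; have hb' := hBmem _ hcell'
    have hfl := hBfloor _ hcell; have hfl' := hBfloor _ hcell'
    -- cell n' < cell n, so B (cell n') < B (cell n)
    have hlt : B (cell n') < B (cell n) := by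
      by_contra hle; rw [not_lt] at hle
      have := Int.floor_le_floor hle
      rw [hfl, hfl'] at this
      have this' : (-(n : ℤ) - 1) ≤ -(n' : ℤ) - 1 := this
      omega
    have hmono : V (B (cell n')) ≤ U (B (cell n)) :=
      top_mono p (hV _ hb') (hU _ hb) (hTV _ hb') (hTU _ hb) hlt
    have h1 := (hTU _ hb) (V (B (cell n'))) (hV _ hb')   -- L v' + v' b ≤ L u + u b   (b = B (cell n) < 0)
    have hbn := hneg n hn
    have hn0 : (0 : ℝ) ≤ n := Nat.cast_nonneg n
    have hmono' : ((V (B (cell n')) : ℕ) : ℝ) ≤ U (B (cell n)) := by exact_mod_cast hmono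
    show newtonLog p (V (B (cell n'))) ≤ newtonLog p (U (B (cell n)))
    nlinarith [mul_le_mul_of_nonneg_right hmono' (by linarith : (0 : ℝ) ≤ -B (cell n))]
  · intro n hn
    exact (newtonLog_mem_Icc p A hA h hlo hhi (hV _ (hBmem _ (hmemS n hn)))).2
  · intro n hn
    exact (newtonLog_mem_Icc p A hA h hlo hhi (hU _ (hBmem _ (hmemS n hn)))).1

/-- from `N(N−1) ≤ 2h` to `N ≤ √(2h) + 1`. [folklore] -/
theorem le_sqrt_succ_of_mul_pred_le (N h : ℕ) (hN : (N : ℝ) * ((N : ℝ) - 1) ≤ 2 * h) : N ≤ Nat.sqrt (2 * h) + 1 := by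
  rcases Nat.eq_zero_or_pos N with h0 | hpos
  · omega
  · have hnat : (N - 1) * (N - 1) ≤ 2 * h := by
      have hc : (((N - 1 : ℕ)) : ℝ) = (N : ℝ) - 1 := by
        rw [Nat.cast_sub hpos]; simp
      have h1 : (((N - 1 : ℕ)) : ℝ) * (((N - 1 : ℕ)) : ℝ) ≤ 2 * h := by
        rw [hc]
        have : (0 : ℝ) ≤ (N : ℝ) - 1 := by rw [← hc]; exact Nat.cast_nonneg _
        nlinarith
      exact_mod_cast h1
    have := Nat.le_sqrt.2 hnat
    omega

/-- **R3, THE HEIGHT RUNG**: a real polynomial whose nonzero coefficients lie in `[A, A·2^h]` in absolute value has its TRUE Newton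
breakpoints in at most `2⌊√(2h)⌋ + 2` unit cells — cells grow like the SQUARE ROOT of the coefficient height (one-sided bound tight:
`c_e = 2^{−e(e−1)/2}`). [folklore; this line] -/
theorem card_newtonCells_le_of_height (p : ℝ[X]) (A : ℝ) (hA : 0 < A) (h : ℕ)
    (hlo : ∀ e ∈ p.support, A ≤ |p.coeff e|) (hhi : ∀ e ∈ p.support, |p.coeff e| ≤ A * 2 ^ h) :
    (newtonCells p).card ≤ 2 * Nat.sqrt (2 * h) + 2 := by
  classical
  have hsplit := Finset.card_filter_add_card_filter_not (s := newtonCells p) (fun c : ℤ => 0 ≤ c)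
  have h1 := le_sqrt_succ_of_mul_pred_le _ h (nonneg_cells_bound p A hA h hlo hhi)
  have h2' : ((newtonCells p).filter (fun c : ℤ => ¬ 0 ≤ c)) = ((newtonCells p).filter (fun c : ℤ => c < 0)) := by
    congr 1; ext c; simp [not_le]
  have h2 := le_sqrt_succ_of_mul_pred_le _ h (neg_cells_bound p A hA h hlo hhi)
  rw [← h2'] at h2
  omega


/-- **Ω from height and term count alone** (representation-free, design-free, depth-free):
`Ω(f) ≤ (2(⌊log₂ t⌋+2)+2) · (2⌊√(2h)⌋+2)`. [this line] -/
theorem octaveCount_le_of_height (p : ℝ[X]) (A : ℝ) (hA : 0 < A) (h : ℕ)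
    (hlo : ∀ e ∈ p.support, A ≤ |p.coeff e|) (hhi : ∀ e ∈ p.support, |p.coeff e| ≤ A * 2 ^ h) :
    octaveCount p ≤ (2 * (Nat.log 2 p.support.card + 2) + 2) * (2 * Nat.sqrt (2 * h) + 2) :=
  (octaveCount_le_newtonCells p).trans (Nat.mul_le_mul_left _ (card_newtonCells_le_of_height p A hA h hlo hhi))


end Summit.ValiantsHypothesis.ValiantsHypothesis.Theorems.KPlusLogSqLaw.Octave
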